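import Literature.AnabelianGeometry.SemiGraphs.SubgroupPresentationStabilizers
import Literature.AnabelianGeometry.SemiGraphs.SubdivisionLemmas
import Literature.AnabelianGeometry.SemiGraphs.TemperedPiPresentationTowerInputs
import Literature.AnabelianGeometry.SemiGraphs.TemperedPiTreeCosetIso
import HarnessLib

/-!
# [SemiAnbd] Thm 3.7 (iv) p. 41, presentation form: the edge group is the meet of its two positioned
# vertex groups, `M_e = s_b⁻¹ H_w s_b ∩ s_{b'}⁻¹ H_{w'} s_{b'}` (T54-B, piece hEI-inst)

Mochizuki, *Semi-graphs of anabelioids*, Publ. RIMS **42** (2006), Thm. 3.7 (iv) p. 41 (the edge-like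
subgroups are the nontrivial intersections of the two adjacent verticial subgroups) and the proof of
Thm. 3.7 (iii) p. 41 (the trees `𝒢_{∞,i}`) [cite: MochizukiSemiAnbd2006, Thm 3.7(iv) p.41].

PROOF-ONLY (cell row T54-B, producer debt `HOME/plan/GAP-LEDGER.md` G-w4d053-1; node SemiAnbd:Thm5.4).
abc-iut-w4-d082's `isArithCompatible_piPresentation_outerAction_of_thm37` (the capstone's `hP`) carries the
binder `hEI` ("Thm 3.7 (iv) clause 2 in presentation currency"): for the two branches `b ≠ b'` of an edge
`e`, abutting to `w`, `w'`, `x ∈ M_e ↔ s_b x s_b⁻¹ ∈ H_w ∧ s_{b'} x s_{b'}⁻¹ ∈ H_{w'}`.  THIS FILE proves it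
for abc-iut-L3-d4's presentation `D.piPresentation h𝒢 T R` of `𝔾` in `π₁^temp(𝒢)` from the TOWER OF TREES
alone (no Thm 3.7 (iv) named fact):

* `SemiGraph.edgeOf_eq_of_isAcyclic` — **a tree has no double edges**: two edges each joining the distinct
  vertices `v ≠ w` coincide (else the circuit `v – e₁ – w – e₂ – v`; companion of abc-iut-L3-t11's
  `branch_unique_of_isAcyclic`, "no loops");
* `SubgroupPresentation.mem_mul_of_conj_mem_of_isTree` — ONE LEVEL: if the coset semi-graph at a normal
  level `K` is a tree and `s_b x s_b⁻¹ ∈ H_w`, `s_{b'} x s_{b'}⁻¹ ∈ H_{w'}`, then `x ∈ M_e · K`: the deck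
  transformation of `x` fixes the two (distinct) ends `H_w s_b K`, `H_{w'} s_{b'} K` of the edge `M_e K`
  (abc-iut-w4-d059's `deckAct_fixes_vMk_iff`), so `x · (M_e K)` is a second edge over `e` with the same
  ends, hence equal to it, i.e. `x ∈ M_e · K` (`deckAct_fixes_eMk_iff`);
* `SubgroupPresentation.mem_M_iff_of_isTree_of_hMK` — over a family of tree levels with `⋂_j M_e K_j = M_e`
  (`hMK`), the `↔` statement;
* **`GaloisLevelData.piPresentation_hEI`** — the binder text of `hEI` VERBATIM at
  `P := D.piPresentation h𝒢 T R` with NO hypothesis (tree levels `ker ρ_n` via abc-iut-L3-d4's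
  `treeCosetIso`, `hMK` = this seat's `piPresentation_hMK`); `piPresentation_hinf` — the containment half
  (abc-iut-w4-d082's halved binder `hinf`), likewise closed.

Nothing here refers to the IUT corpus; no side is taken on [IUTchIII] Cor 3.12; typed ≠ proved for Thm 5.4 itself.
-/

namespace Literature.AnabelianGeometry.SemiGraphs

open CategoryTheory
open scoped Pointwise

universe v u

/-! ### A tree has no double edges -/

namespace SemiGraph

variable {G : SemiGraph.{u}}

/-- **A tree has no double edges**: if the branches `b₁`, `c₁` of one edge and `b₂`, `c₂` of another abut
to the same pair of DISTINCT vertices `v ≠ w` (`bᵢ` to `v`, `cᵢ` to `w`), the two edges coincide — else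
the two paths `v – bᵢ – eᵢ – cᵢ – w` of the subdivision contradict path uniqueness.
[cite: MochizukiSemiAnbd2006, §1 p.13] -/
theorem edgeOf_eq_of_isAcyclic (hG : G.subdivision.IsAcyclic) {b₁ c₁ b₂ c₂ : G.Branch} {v w : G.Vertex}
    (hvw : v ≠ w) (h₁ : G.edgeOf c₁ = G.edgeOf b₁) (h₂ : G.edgeOf c₂ = G.edgeOf b₂)
    (hb₁ : G.abuts b₁ = some v) (hc₁ : G.abuts c₁ = some w)
    (hb₂ : G.abuts b₂ = some v) (hc₂ : G.abuts c₂ = some w) :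
    G.edgeOf b₁ = G.edgeOf b₂ := by
  have hbc₁ : b₁ ≠ c₁ := by
    rintro rfl
    exact hvw (Option.some_injective _ (hb₁.symm.trans hc₁))
  have hbc₂ : b₂ ≠ c₂ := by
    rintro rfl
    exact hvw (Option.some_injective _ (hb₂.symm.trans hc₂))
  -- the walks `v → bᵢ → eᵢ → cᵢ → w`
  have a₁ : G.subdivision.Adj (Sum.inl v) (Sum.inr (Sum.inr b₁)) :=
    (G.subdivision_adj_inl_iff v _).mpr ⟨b₁, hb₁, rfl⟩
  have a₂ : G.subdivision.Adj (Sum.inl v) (Sum.inr (Sum.inr b₂)) :=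
    (G.subdivision_adj_inl_iff v _).mpr ⟨b₂, hb₂, rfl⟩
  have d₁ : G.subdivision.Adj (Sum.inr (Sum.inr b₁)) (Sum.inr (Sum.inl (G.edgeOf b₁))) :=
    (G.subdivision_adj_branch_iff b₁ _).mpr (Or.inl rfl)
  have d₂ : G.subdivision.Adj (Sum.inr (Sum.inr b₂)) (Sum.inr (Sum.inl (G.edgeOf b₂))) :=
    (G.subdivision_adj_branch_iff b₂ _).mpr (Or.inl rfl)
  have f₁ : G.subdivision.Adj (Sum.inr (Sum.inl (G.edgeOf b₁))) (Sum.inr (Sum.inr c₁)) :=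
    (G.subdivision_adj_edge_iff _ _).mpr ⟨c₁, h₁, rfl⟩
  have f₂ : G.subdivision.Adj (Sum.inr (Sum.inl (G.edgeOf b₂))) (Sum.inr (Sum.inr c₂)) :=
    (G.subdivision_adj_edge_iff _ _).mpr ⟨c₂, h₂, rfl⟩
  have g₁ : G.subdivision.Adj (Sum.inr (Sum.inr c₁)) (Sum.inl w) :=
    (G.subdivision_adj_branch_iff c₁ _).mpr (Or.inr ⟨w, hc₁, rfl⟩)
  have g₂ : G.subdivision.Adj (Sum.inr (Sum.inr c₂)) (Sum.inl w) :=
    (G.subdivision_adj_branch_iff c₂ _).mpr (Or.inr ⟨w, hc₂, rfl⟩)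
  let p₁ : G.subdivision.Walk (Sum.inl v) (Sum.inl w) :=
    SimpleGraph.Walk.cons a₁ (SimpleGraph.Walk.cons d₁ (SimpleGraph.Walk.cons f₁
      (SimpleGraph.Walk.cons g₁ SimpleGraph.Walk.nil)))
  let p₂ : G.subdivision.Walk (Sum.inl v) (Sum.inl w) :=
    SimpleGraph.Walk.cons a₂ (SimpleGraph.Walk.cons d₂ (SimpleGraph.Walk.cons f₂
      (SimpleGraph.Walk.cons g₂ SimpleGraph.Walk.nil)))
  have hp₁ : p₁.IsPath := by simp [p₁, SimpleGraph.Walk.isPath_def, hvw, hbc₁]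
  have hp₂ : p₂.IsPath := by simp [p₂, SimpleGraph.Walk.isPath_def, hvw, hbc₂]
  have h := congrArg (fun q : G.subdivision.Path _ _ => q.1.getVert 2) (hG.path_unique ⟨p₁, hp₁⟩ ⟨p₂, hp₂⟩)
  simpa [p₁, p₂] using h

end SemiGraph

/-! ### One level: the two positioned vertex groups meet in `M_e · K` -/

namespace SemiGraph.SubgroupPresentation

variable {𝔾 : SemiGraph.{u}} {Γ : Type u} [Group Γ] (P : SubgroupPresentation 𝔾 Γ)

/-- **One tree level**: if `P.cosetGraph K` is a tree (`K` normal) then for the two branches `b ≠ b'` of an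
edge `e`, abutting to `w`, `w'`, every `x` with `s_b x s_b⁻¹ ∈ H_w` and `s_{b'} x s_{b'}⁻¹ ∈ H_{w'}` lies in
`M_e · K`: its deck transformation fixes the two distinct ends of the edge `M_e·1·K`, hence (no double
edges in a tree) that edge. [cite: MochizukiSemiAnbd2006, Thm 3.7(iv) p.41] -/
theorem mem_mul_of_conj_mem_of_isTree (K : Subgroup Γ) [K.Normal] (hT : (P.cosetGraph K).IsTree)
    {b b' : 𝔾.Branch} (hbb' : b ≠ b') (he : 𝔾.edgeOf b = 𝔾.edgeOf b') {w w' : 𝔾.Vertex}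
    (hw : 𝔾.abuts b = some w) (hw' : 𝔾.abuts b' = some w') {x : Γ}
    (hx : P.s b * x * (P.s b)⁻¹ ∈ P.H w) (hx' : P.s b' * x * (P.s b')⁻¹ ∈ P.H w') :
    x ∈ (P.M (𝔾.edgeOf b) : Set Γ) * (K : Set Γ) := by
  have hacyc := hT.isTree.isAcyclic
  -- the ends of the edge `M_e·1·K`
  have hend : (P.cosetGraph K).abuts (P.bMk K b 1) = some (P.vMk K w (P.s b)) := by
    simpa only [mul_one] using P.cosetGraph_abuts_bMk K b w hw 1
  have hend' : (P.cosetGraph K).abuts (P.bMk K b' 1) = some (P.vMk K w' (P.s b')) := by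
    simpa only [mul_one] using P.cosetGraph_abuts_bMk K b' w' hw' 1
  -- they are distinct (no loops in a tree)
  have hne : P.vMk K w (P.s b) ≠ P.vMk K w' (P.s b') := by
    intro hV
    refine hbb' ?_
    have hedge : (P.cosetGraph K).edgeOf (P.bMk K b 1) = (P.cosetGraph K).edgeOf (P.bMk K b' 1) := by
      change P.eMk K (𝔾.edgeOf b) 1 = P.eMk K (𝔾.edgeOf b') 1
      rw [he]
    have h12 : P.bMk K b 1 = P.bMk K b' 1 :=
      SemiGraph.branch_unique_of_isAcyclic hacyc hedge hend (by rw [hV]; exact hend')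
    exact congrArg (fun br : (P.cosetGraph K).Branch => br.1.1) h12
  -- the deck transformation of `x` fixes both ends
  have hfix : (P.deckAct K x).hom.vertexMap (P.vMk K w (P.s b)) = P.vMk K w (P.s b) :=
    (P.deckAct_fixes_vMk_iff K x w (P.s b)).mpr
      (Set.mem_mul.mpr ⟨_, hx, 1, K.one_mem, mul_one _⟩)
  have hfix' : (P.deckAct K x).hom.vertexMap (P.vMk K w' (P.s b')) = P.vMk K w' (P.s b') :=
    (P.deckAct_fixes_vMk_iff K x w' (P.s b')).mpr
      (Set.mem_mul.mpr ⟨_, hx', 1, K.one_mem, mul_one _⟩)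
  -- so the translated edge `M_e x⁻¹ K` has the same two ends
  have hxend : (P.cosetGraph K).abuts (P.bMk K b (1 * x⁻¹)) = some (P.vMk K w (P.s b)) := by
    rw [P.cosetGraph_abuts_bMk K b w hw, ← mul_assoc, ← P.deckAct_vertexMap_vMk K x w, mul_one, hfix]
  have hxend' : (P.cosetGraph K).abuts (P.bMk K b' (1 * x⁻¹)) = some (P.vMk K w' (P.s b')) := by
    rw [P.cosetGraph_abuts_bMk K b' w' hw', ← mul_assoc, ← P.deckAct_vertexMap_vMk K x w', mul_one, hfix']
  -- no double edges: `M_e·1·K = M_e·x⁻¹·K`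
  have hEq : (P.cosetGraph K).edgeOf (P.bMk K b 1) = (P.cosetGraph K).edgeOf (P.bMk K b (1 * x⁻¹)) :=
    SemiGraph.edgeOf_eq_of_isAcyclic hacyc hne
      (show (P.cosetGraph K).edgeOf (P.bMk K b' 1) = (P.cosetGraph K).edgeOf (P.bMk K b 1) by
        change P.eMk K (𝔾.edgeOf b') 1 = P.eMk K (𝔾.edgeOf b) 1; rw [he])
      (show (P.cosetGraph K).edgeOf (P.bMk K b' (1 * x⁻¹)) =
          (P.cosetGraph K).edgeOf (P.bMk K b (1 * x⁻¹)) by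
        change P.eMk K (𝔾.edgeOf b') (1 * x⁻¹) = P.eMk K (𝔾.edgeOf b) (1 * x⁻¹); rw [he])
      hend hend' hxend hxend'
  -- i.e. `x` fixes the edge `M_e·1·K`, i.e. `x ∈ M_e · K`
  have hfixE : (P.deckAct K x).hom.edgeMap (P.eMk K (𝔾.edgeOf b) 1) = P.eMk K (𝔾.edgeOf b) 1 := by
    rw [P.deckAct_edgeMap_eMk]
    exact hEq.symm
  have := (P.deckAct_fixes_eMk_iff K x (𝔾.edgeOf b) 1).mp hfixE
  simpa only [one_mul, inv_one, mul_one] using this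

/-- **Over a tower of tree levels with `⋂_j M_e · K_j = M_e` (`hMK`)**: for the two branches `b ≠ b'` of
`e`, abutting to `w`, `w'`, `x ∈ M_e ↔ s_b x s_b⁻¹ ∈ H_w ∧ s_{b'} x s_{b'}⁻¹ ∈ H_{w'}` — Thm 3.7 (iv)
clause 2 in presentation currency. [cite: MochizukiSemiAnbd2006, Thm 3.7(iv) p.41] -/
theorem mem_M_iff_of_isTree_of_hMK {J : Type v} (K : J → Subgroup Γ) [∀ j, (K j).Normal]
    (hT : ∀ j, (P.cosetGraph (K j)).IsTree)
    (hMK : ∀ (e : 𝔾.Edge) (x : Γ), (∀ j, x ∈ (P.M e : Set Γ) * (K j : Set Γ)) → x ∈ P.M e)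
    {b b' : 𝔾.Branch} (hbb' : b ≠ b') (he : 𝔾.edgeOf b = 𝔾.edgeOf b') {w w' : 𝔾.Vertex}
    (hw : 𝔾.abuts b = some w) (hw' : 𝔾.abuts b' = some w') (x : Γ) :
    x ∈ P.M (𝔾.edgeOf b) ↔ P.s b * x * (P.s b)⁻¹ ∈ P.H w ∧ P.s b' * x * (P.s b')⁻¹ ∈ P.H w' := by
  constructor
  · intro hx
    exact ⟨P.conj_mem b w hw x hx, P.conj_mem b' w' hw' x (he ▸ hx)⟩
  · rintro ⟨hx, hx'⟩
    exact hMK _ x fun j => P.mem_mul_of_conj_mem_of_isTree (K j) (hT j) hbb' he hw hw' hx hx'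

end SemiGraph.SubgroupPresentation

/-! ### The tempered instantiation: `hEI` for `D.piPresentation T R`, no hypothesis -/

namespace ProfiniteSemiGraph

namespace GaloisLevelData

variable {𝒢 : ProfiniteSemiGraph.{u}} (D : GaloisLevelData 𝒢) (h𝒢 : 𝒢.IsCountable)
  (T : ∀ w : 𝒢.graph.Vertex, D.PointSeq h𝒢 w) (R : SemiGraph.RefBranches 𝒢.graph)

/-- **`hEI` at `π₁^temp(𝒢)`** (Thm 3.7 (iv) clause 2 for the decomposition-group presentation): for the two
branches `b ≠ b'` of an edge, abutting to `w`, `w'`, `x ∈ M_e ↔ s_b x s_b⁻¹ ∈ H_w ∧ s_{b'} x s_{b'}⁻¹ ∈ H_{w'}`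
— abc-iut-w4-d082's binder `hEI` VERBATIM at `P := D.piPresentation h𝒢 T R`, with NO hypothesis (tree
levels `ker ρ_n`, `hMK` from compactness). [cite: MochizukiSemiAnbd2006, Thm 3.7(iv) p.41] -/
theorem piPresentation_hEI :
    ∀ (b b' : 𝒢.graph.Branch) (w w' : 𝒢.graph.Vertex), b ≠ b' →
      𝒢.graph.edgeOf b = 𝒢.graph.edgeOf b' → 𝒢.graph.abuts b = some w → 𝒢.graph.abuts b' = some w' →
      ∀ x, x ∈ (D.piPresentation h𝒢 T R).M (𝒢.graph.edgeOf b) ↔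
        (D.piPresentation h𝒢 T R).s b * x * ((D.piPresentation h𝒢 T R).s b)⁻¹ ∈
            (D.piPresentation h𝒢 T R).H w ∧
          (D.piPresentation h𝒢 T R).s b' * x * ((D.piPresentation h𝒢 T R).s b')⁻¹ ∈
            (D.piPresentation h𝒢 T R).H w' :=
  fun _ _ _ _ hbb' he hw hw' x =>
    (D.piPresentation h𝒢 T R).mem_M_iff_of_isTree_of_hMK (fun n => (D.projAut h𝒢 n).ker)
      (fun n => SemiGraph.IsTree.of_iso (D.treeCosetIso h𝒢 T R n).symm (D.isTree_tree n))
      (D.piPresentation_hMK h𝒢 T R) hbb' he hw hw' x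

/-- **`hinf` at `π₁^temp(𝒢)`** — the CONTAINMENT `s_b⁻¹ H_w s_b ⊓ s_{b'}⁻¹ H_{w'} s_{b'} ≤ M_e` (abc-iut-w4-d082's
halved binder `hinf` of `isArithCompatible_piPresentation_outerAction_of_thm37_of_inf_le`, VERBATIM at
`P := D.piPresentation h𝒢 T R`), with NO hypothesis: the Thm 3.7 (iv) clause-2 direction, from the tower of
trees (no `EdgeLikeIsInfVerticial` fact consumed). [cite: MochizukiSemiAnbd2006, Thm 3.7(iv) p.41] -/
theorem piPresentation_hinf :
    ∀ (b b' : 𝒢.graph.Branch) (w w' : 𝒢.graph.Vertex), b ≠ b' →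
      𝒢.graph.edgeOf b = 𝒢.graph.edgeOf b' → 𝒢.graph.abuts b = some w → 𝒢.graph.abuts b' = some w' →
      ∀ x, (D.piPresentation h𝒢 T R).s b * x * ((D.piPresentation h𝒢 T R).s b)⁻¹ ∈
            (D.piPresentation h𝒢 T R).H w →
        (D.piPresentation h𝒢 T R).s b' * x * ((D.piPresentation h𝒢 T R).s b')⁻¹ ∈
            (D.piPresentation h𝒢 T R).H w' →
        x ∈ (D.piPresentation h𝒢 T R).M (𝒢.graph.edgeOf b) :=
  fun b b' w w' hbb' he hw hw' x hx hx' =>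
    (D.piPresentation_hEI h𝒢 T R b b' w w' hbb' he hw hw' x).mpr ⟨hx, hx'⟩

end GaloisLevelData

end ProfiniteSemiGraph

end Literature.AnabelianGeometry.SemiGraphs

/-! ### v2 (append-only): the two ends of an edge of a tree level are DISTINCT vertices -/

namespace Literature.AnabelianGeometry.SemiGraphs

universe u₁

namespace SemiGraph.SubgroupPresentation

variable {𝔾 : SemiGraph.{u₁}} {Γ : Type u₁} [Group Γ] (P : SubgroupPresentation 𝔾 Γ)

/-- **The two ends of an edge of a tree level are distinct**: if `P.cosetGraph K` is a tree then for the two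
branches `b ≠ b'` of an edge, abutting to `w`, `w'`, the end vertices `H_w s_b y K ≠ H_{w'} s_{b'} y K` of the
edge `M_e y K` (no loops in a tree; one level of abc-iut-w4-d059's `ends_eMk_system`, exported for the
capstone's `hEc` producer). [cite: MochizukiSemiAnbd2006, Thm 3.7(iii) p.41] -/
theorem vMk_s_mul_ne_of_isTree (K : Subgroup Γ) (hT : (P.cosetGraph K).IsTree)
    {b b' : 𝔾.Branch} (hbb' : b ≠ b') (he : 𝔾.edgeOf b = 𝔾.edgeOf b') {w w' : 𝔾.Vertex}
    (hw : 𝔾.abuts b = some w) (hw' : 𝔾.abuts b' = some w') (y : Γ) :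
    P.vMk K w (P.s b * y) ≠ P.vMk K w' (P.s b' * y) := by
  intro hV
  refine hbb' ?_
  have hedge : (P.cosetGraph K).edgeOf (P.bMk K b y) = (P.cosetGraph K).edgeOf (P.bMk K b' y) := by
    change P.eMk K (𝔾.edgeOf b) y = P.eMk K (𝔾.edgeOf b') y
    rw [he]
  have h12 : P.bMk K b y = P.bMk K b' y :=
    SemiGraph.branch_unique_of_isAcyclic hT.isTree.isAcyclic hedge (P.cosetGraph_abuts_bMk K b w hw y)
      (by rw [hV]; exact P.cosetGraph_abuts_bMk K b' w' hw' y)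
  exact congrArg (fun br : (P.cosetGraph K).Branch => br.1.1) h12

end SemiGraph.SubgroupPresentation

namespace ProfiniteSemiGraph.GaloisLevelData

variable {𝒢 : ProfiniteSemiGraph.{u₁}} (D : GaloisLevelData 𝒢) (h𝒢 : 𝒢.IsCountable)
  (T : ∀ w : 𝒢.graph.Vertex, D.PointSeq h𝒢 w) (R : SemiGraph.RefBranches 𝒢.graph)

/-- **At `π₁^temp(𝒢)`**: at every tree level `ker ρ_n`, the two ends `H_w s_b y ker ρ_n ≠ H_{w'} s_{b'} y ker ρ_n`
of an edge of `𝒢_{∞,n}` are distinct, for the two branches `b ≠ b'` of any edge of `𝔾`.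
[cite: MochizukiSemiAnbd2006, Thm 3.7(iii) p.41] -/
theorem piPresentation_vMk_s_mul_ne (n : ℕ) {b b' : 𝒢.graph.Branch} (hbb' : b ≠ b')
    (he : 𝒢.graph.edgeOf b = 𝒢.graph.edgeOf b') {w w' : 𝒢.graph.Vertex}
    (hw : 𝒢.graph.abuts b = some w) (hw' : 𝒢.graph.abuts b' = some w') (y : D.temperedPi h𝒢) :
    (D.piPresentation h𝒢 T R).vMk (D.projAut h𝒢 n).ker w ((D.piPresentation h𝒢 T R).s b * y) ≠
      (D.piPresentation h𝒢 T R).vMk (D.projAut h𝒢 n).ker w' ((D.piPresentation h𝒢 T R).s b' * y) :=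
  (D.piPresentation h𝒢 T R).vMk_s_mul_ne_of_isTree (D.projAut h𝒢 n).ker
    (SemiGraph.IsTree.of_iso (D.treeCosetIso h𝒢 T R n).symm (D.isTree_tree n)) hbb' he hw hw' y

end ProfiniteSemiGraph.GaloisLevelData

end Literature.AnabelianGeometry.SemiGraphs
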